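import Literature.RepresentationTheory.HeisenbergGroup.ImplementerCocycle
import Literature.RepresentationTheory.HeisenbergGroup.SchrodingerModel
import Mathlib.MeasureTheory.Group.Measure
import Mathlib.MeasureTheory.Integral.Bochner.Basic
import Mathlib.MeasureTheory.Function.LocallyIntegrable
import HarnessLib

/-!
# The abelian subgroup of an isotropic subspace in the Heisenberg group, its transport under implementers, and the
# Gaussian eigenfunctional of the Schrödinger model along a Lagrangian graph

Topic `RepresentationTheory/HeisenbergGroup`; namespace `Literature.RepresentationTheory.HeisenbergGroup`.
KERNEL ONLY: theorems (no definition, no record, no named fact, no `sorry`).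

Two elementary ingredients of the proof of the STABLE-RANGE LEMMA of the theta correspondence
([MoeglinVignerasWaldspurger1987, Chap. 3 §IV.2 Lemme, p. 76]; consumer
`MoeglinVignerasWaldspurger1987/RankOneThetaLiftNonvanishingProofs.lean`) written for the tree's Heisenberg group
`Heisenberg B` (law `(w,t)(w',t') = (w+w', t+t'+B w w')`, `HeisenbergGroup.lean`) and Schrödinger model
`schrodinger β ψ` / `schrodingerSB` (`SchrodingerModel.lean`):

* §1 MVW's section `w ↦ (w, 0)` of `H(W) → W` reads, in the tree's coordinates (dictionary `t ↦ t - ½ B(w,w)` of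
  `HeisenbergGroup.lean`), `w ↦ (w, ½ B(w,w))`.  On a subspace where `B` is SYMMETRIC (= isotropic for the commutator
  form `alt B`) it is a HOMOMORPHISM (`Heisenberg.mk_half_mul_mk_half`), and it is EQUIVARIANT for Weil's section
  `ofSymplectic` of `Sp(alt B)` (`act_ofSymplectic_mk_half`: `g · (w, ½B(w,w)) = (g w, ½ B(gw,gw))` — the central
  corrections cancel exactly); hence every implementing pair `(g, M) ∈ MpPsi ρ` satisfies
  `M ρ(w, ½B(w,w)) = ρ(gw, ½B(gw,gw)) M` (`MpPsi.toRep_apply_mk_half`) — [MoeglinVignerasWaldspurger1987, Chap. 2 II.1 (A)]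
  on these elements, with NO scalar ambiguity.
* §2 the GAUSSIAN EIGENFUNCTIONAL: for a «second-degree» function `q : X → R` and an additive `l : X → R`, the linear
  form `Φ ↦ ∫_X ψ(q u - l u) Φ(u) du` (any right-invariant measure) transforms under the Schrödinger operator of
  `((x, y), q x)` by the character `ψ(l x)` AS SOON AS `q (u + x) = q u + q x + β u y` for all `u`
  (`integral_gauss_mul_schrodinger`, `…_schrodingerSB`; the pointwise identity `schrodinger_gauss_shift`); for
  `q u = ½ β(u, S u)` with `S` symmetric this is the condition `β(·, y) = β(·, S x)`, i.e. `(x, y)` lies on the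
  Lagrangian graph of `S`, and `((x,y), q x) = ((x,y), ½ B((x,y),(x,y)))` is the element of §1 — the functional is an
  eigenfunctional of the abelian subgroup of §1 for every isotropic subspace inside that graph (the «evaluation along
  an orbit» of MVW's mixed-model proof, transported to the Schrödinger model on `𝒮(X)`).  It is a LINEAR FORM on
  `𝒮(X)` (`exists_linearMap_eq_integral_gauss_mul`: Schwartz–Bruhat functions are integrable for a measure finite on
  compacta) and does not vanish on the indicator of a set where the phase is `1` (`integral_gauss_mul_indicator`).

## References
* [MoeglinVignerasWaldspurger1987] C. Mœglin, M.-F. Vignéras, J.-L. Waldspurger, *Correspondances de Howe sur un corps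
  p-adique*, LNM 1291 (1987), Chap. 2 I.1–I.4, II.1 (A); Chap. 3 §IV.2 (proof of the Lemme, p. 76).
* [Weil1964] A. Weil, *Sur certains groupes d'opérateurs unitaires*, Acta Math. 111 (1964), n° 4–6, n° 13.
-/

set_option autoImplicit false

noncomputable section

open _root_.MeasureTheory
open Literature.NumberTheory.Automorphic (SchwartzBruhat mem_schwartzBruhat_iff)

namespace Literature.RepresentationTheory.HeisenbergGroup

universe u v w

/-! ## §1 The section `w ↦ (w, ½ B(w,w))` on an isotropic subspace and its transport under implementers -/

section IsotropicSection

variable {R : Type u} [CommRing R] [Invertible (2 : R)] {V : Type v} [AddCommGroup V] [Module R V]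
  (B : V →ₗ[R] V →ₗ[R] R)

/-- **`w ↦ (w, ½ B(w,w))` is additive on `B`-symmetric pairs**: if `B w w' = B w' w` (i.e. `alt B (w, w') = 0`) then
`(w, ½B(w,w)) · (w', ½B(w',w')) = (w + w', ½ B(w+w', w+w'))` in `Heisenberg B` — MVW's abelian subgroup
`{(w, 0) : w ∈ L}` of an isotropic subspace `L`, in the tree's coordinates.
[cite: MoeglinVignerasWaldspurger1987, Chap. 2 I.1] -/
theorem Heisenberg.mk_half_mul_mk_half {w w' : V} (h : B w w' = B w' w) :
    (⟨w, ⅟(2 : R) * B w w⟩ : Heisenberg B) * ⟨w', ⅟(2 : R) * B w' w'⟩ = ⟨w + w', ⅟(2 : R) * B (w + w') (w + w')⟩ := by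
  have h2 : (⅟(2 : R)) * 2 = 1 := invOf_mul_self _
  ext
  · rfl
  · simp only [Heisenberg.mul_t, map_add, LinearMap.add_apply, ← h]
    linear_combination (-(B w w')) * h2

/-- **Weil's section is equivariant for `w ↦ (w, ½ B(w,w))`**: `ofSymplectic g` maps `(w, ½B(w,w))` to
`(g w, ½ B(gw, gw))` (its central correction `½(B(gw,gw) - B(w,w))` is exactly what is needed).
[cite: Weil1964, n° 5 (5)–(7), pp. 149–151] -/
theorem act_ofSymplectic_mk_half (g : symplecticGroup B) (w : V) :
    (ofSymplectic B g).act ⟨w, ⅟(2 : R) * B w w⟩ = ⟨g.1 w, ⅟(2 : R) * B (g.1 w) (g.1 w)⟩ := by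
  ext
  · rfl
  · simp only [Heisenberg.PseudoSymplectic.act_t, ofSymplectic_f]
    ring

variable {k : Type*} [Field k] {S : Type*} [AddCommGroup S] [Module k S] (ρ : Representation k (Heisenberg B) S)

/-- **implementers transport the abelian subgroup of an isotropic subspace without scalars**: for every pair
`(g, M) ∈ S̃p_ψ = MpPsi ρ` and every `w`, `M (ρ(w, ½B(w,w)) f) = ρ(g w, ½ B(gw,gw)) (M f)` — condition (A) of
[MoeglinVignerasWaldspurger1987, Chap. 2 II.1] evaluated on the section of §1.
[cite: MoeglinVignerasWaldspurger1987, Chap. 2 II.1 (A)] -/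
theorem MpPsi.toRep_apply_mk_half (p : MpPsi ρ) (w : V) (f : S) :
    MpPsi.toRep ρ p (ρ ⟨w, ⅟(2 : R) * B w w⟩ f) =
      ρ ⟨((p : symplecticGroup B × (S ≃ₗ[k] S)).1).1 w,
          ⅟(2 : R) * B (((p : symplecticGroup B × (S ≃ₗ[k] S)).1).1 w) (((p : symplecticGroup B × (S ≃ₗ[k] S)).1).1 w)⟩
        (MpPsi.toRep ρ p f) := by
  have h := MpPsi.toRep_implements ρ p ⟨w, ⅟(2 : R) * B w w⟩ f
  rw [act_ofSymplectic_mk_half] at h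
  exact h

end IsotropicSection

/-! ## §2 The Gaussian eigenfunctional of the Schrödinger model -/

section Gauss

variable {R : Type u} [CommRing R] {X : Type v} {Y : Type w} [AddCommGroup X] [Module R X] [AddCommGroup Y]
  [Module R Y] (β : X →ₗ[R] Y →ₗ[R] R) (ψ : AddChar R Circle)

/-- **the pointwise identity behind the Gaussian eigenfunctional**: for `q : X → R`, `l : X →+ R` and `(x, y)` with
`q (u + x) = q u + q x + β u y` for all `u`,
`ψ(q u - l u) · (ρ((x,y), q x) f)(u) = ψ(l x) · [ψ(q u' - l u') f(u')]_{u' = u + x}`.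
[cite: MoeglinVignerasWaldspurger1987, Chap. 2 I.4 Exemple (1)] -/
theorem schrodinger_gauss_shift (q : X → R) (l : X →+ R) {x : X} {y : Y}
    (hq : ∀ u : X, q (u + x) = q u + q x + β u y) (f : X → ℂ) (u : X) :
    ((ψ (q u - l u) : Circle) : ℂ) * schrodinger β ψ ⟨(x, y), q x⟩ f u =
      ((ψ (l x) : Circle) : ℂ) * (((ψ (q (u + x) - l (u + x)) : Circle) : ℂ) * f (u + x)) := by
  have key : q u - l u + (q x + β u y) = l x + (q (u + x) - l (u + x)) := by
    rw [hq, l.map_add]; abel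
  show ((ψ (q u - l u) : Circle) : ℂ) * (((ψ (q x + β u y) : Circle) : ℂ) * f (u + x)) = _
  rw [← mul_assoc, ← coe_addChar_add, ← mul_assoc, ← coe_addChar_add, key]

variable [MeasurableSpace X] [MeasurableAdd X] (μ : Measure X) [μ.IsAddRightInvariant]

/-- **the Gaussian eigenfunctional identity** for the Schrödinger representation on all functions: with `q`, `l`,
`(x, y)` as in `schrodinger_gauss_shift` and `μ` right-invariant,
`∫ ψ(q u - l u) (ρ((x,y), q x) f)(u) dμ = ψ(l x) ∫ ψ(q u - l u) f(u) dμ` (translation invariance of `μ`).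
[cite: MoeglinVignerasWaldspurger1987, Chap. 3 §IV.2 (proof of the Lemme, p. 76)] -/
theorem integral_gauss_mul_schrodinger (q : X → R) (l : X →+ R) {x : X} {y : Y}
    (hq : ∀ u : X, q (u + x) = q u + q x + β u y) (f : X → ℂ) :
    ∫ u, ((ψ (q u - l u) : Circle) : ℂ) * schrodinger β ψ ⟨(x, y), q x⟩ f u ∂μ =
      ((ψ (l x) : Circle) : ℂ) * ∫ u, ((ψ (q u - l u) : Circle) : ℂ) * f u ∂μ := by
  simp_rw [schrodinger_gauss_shift β ψ q l hq f]
  rw [integral_const_mul]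
  congr 1
  exact integral_add_right_eq_self (fun u => ((ψ (q u - l u) : Circle) : ℂ) * f u) x

variable [TopologicalSpace X] [TopologicalSpace R] [IsTopologicalAddGroup X]

/-- the same identity for the smooth model `schrodingerSB` on `𝒮(X)`.
[cite: MoeglinVignerasWaldspurger1987, Chap. 3 §IV.2 (proof of the Lemme, p. 76)] -/
theorem integral_gauss_mul_schrodingerSB (hψ : IsLocallyConstant (⇑ψ : R → Circle))
    (hβ : ∀ y : Y, Continuous fun u : X => β u y) (q : X → R) (l : X →+ R) {x : X} {y : Y}
    (hq : ∀ u : X, q (u + x) = q u + q x + β u y) (Φ : SchwartzBruhat X) :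
    ∫ u, ((ψ (q u - l u) : Circle) : ℂ) *
        ((schrodingerSB β ψ hψ hβ ⟨(x, y), q x⟩ Φ : SchwartzBruhat X) : X → ℂ) u ∂μ =
      ((ψ (l x) : Circle) : ℂ) * ∫ u, ((ψ (q u - l u) : Circle) : ℂ) * (Φ : X → ℂ) u ∂μ := by
  simp only [coe_schrodingerSB]
  exact integral_gauss_mul_schrodinger β ψ μ q l hq _

end Gauss

section Functional

variable {X : Type v} [MeasurableSpace X] (μ : Measure X)

/-- **the Gaussian functional is a linear form on `𝒮(X)`**: for `μ` finite on compacta and a continuous phase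
`u ↦ ψ(q u - l u)`, there is a `ℂ`-linear `μ_q : 𝒮(X) → ℂ` with `μ_q Φ = ∫ ψ(q u - l u) Φ(u) dμ` (Schwartz–Bruhat
functions are continuous with compact support, hence integrable). [cite: WeilBNT1967, Ch. VII §2, Def. 1] -/
theorem exists_linearMap_eq_integral_gauss_mul [TopologicalSpace X] [OpensMeasurableSpace X] [IsFiniteMeasureOnCompacts μ]
    (c : X → ℂ) (hc : Continuous c) :
    ∃ ℓ : SchwartzBruhat X →ₗ[ℂ] ℂ, ∀ Φ : SchwartzBruhat X, ℓ Φ = ∫ u, c u * (Φ : X → ℂ) u ∂μ := by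
  have hint : ∀ Φ : SchwartzBruhat X, Integrable (fun u => c u * (Φ : X → ℂ) u) μ := fun Φ => by
    obtain ⟨hlc, hcs⟩ := (mem_schwartzBruhat_iff).1 Φ.2
    exact (hc.mul hlc.continuous).integrable_of_hasCompactSupport hcs.mul_left
  refine ⟨{ toFun := fun Φ => ∫ u, c u * (Φ : X → ℂ) u ∂μ
            map_add' := fun Φ Φ' => ?_
            map_smul' := fun a Φ => ?_ }, fun Φ => rfl⟩
  · simp only [Submodule.coe_add, Pi.add_apply, mul_add]
    exact integral_add (hint Φ) (hint Φ')
  · simp only [Submodule.coe_smul, Pi.smul_apply, smul_eq_mul, RingHom.id_apply, mul_left_comm (c _) a]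
    exact integral_const_mul a _

/-- **non-vanishing of the Gaussian functional on an indicator**: if the phase `c` is `1` on a measurable set `O`,
then `∫ c(u) 1_O(u) dμ = μ(O)` (the transform of the characteristic function of a lattice evaluated where the phase
is trivial, [WeilBNT1967, Ch. VII §2, Prop. 2, formula (2)]). [cite: WeilBNT1967, Ch. VII §2, Prop. 2] -/
theorem integral_gauss_mul_indicator (c : X → ℂ) {O : Set X} (hO : MeasurableSet O) (hc : ∀ u ∈ O, c u = 1) :
    ∫ u, c u * O.indicator (fun _ => (1 : ℂ)) u ∂μ = (μ.real O : ℂ) := by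
  have h : (fun u => c u * O.indicator (fun _ => (1 : ℂ)) u) = O.indicator fun _ => (1 : ℂ) := by
    funext u
    by_cases hu : u ∈ O
    · rw [Set.indicator_of_mem hu, hc u hu, mul_one]
    · rw [Set.indicator_of_notMem hu, mul_zero]
  rw [h, integral_indicator_const (1 : ℂ) hO, Complex.real_smul, mul_one]

end Functional

end Literature.RepresentationTheory.HeisenbergGroup

end
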